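import Mathlib
import HarnessLib
import HarnessLib.Audit
import Summits.ValiantsHypothesis.Statement
import Summits.ValiantsHypothesis.ValiantsHypothesis.Theorems.MatrixDescartes.Negative.MatrixDescartesFalseOfTropicalMonster
import Summits.ValiantsHypothesis.ValiantsHypothesis.Theorems.KPlusLogSqLawOctaveGlue
import HarnessLib.Audit.Status.Attr

/-!
Route: KPlusLogSqLawOctave

# Route KPlusLogSqLawOctave — Octave form of Conjecture B — tropical law plus a scale-counting
lifting lemma

X = TB ∧ Ω-W: the TROPICAL HALF of Conjecture B of the cell pub-symmetroid (`TropicalB`, the SAME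
item as route KPlusLogSqLaw's
stmt-ValiantsHypothesis-19771: at most 2^{C (K + ⌊log₂ m⌋²)} sign alternations along a strictly
increasing parameter sequence of dominant
terms of any dominance design of format (m, K)) together with the OCTAVE WEAK LIFTING LEMMA Ω-W
(`OctaveWeakLifting`: if every
dominance design of format (m, K) has at most n alternations, then the determinant of every real
symmetric lacunary pencil
Σ_l X^{d_l} S_l of format (m, K) has its nonzero real roots in at most 2^{C (K + ⌊log₂ m⌋²)}·(n + 1)
dyadic OCTAVES
(`OctaveGlue.OctaveRootLawAt`, the count `octaveCount p = #{⌊log₂|x|⌋ : x ≠ 0, p(x) = 0}`)). Ω-W is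
implied by the sibling's
`WeakLifting` (stmt-19561; `Octave.octaveWeakLifting_of_weakLifting`) and is strictly weaker as a
statement (it ignores root
clustering inside an octave), yet TB ∧ Ω-W still decides VP_ℂ ≠ VNP_ℂ because Tavenas' witness
family has its 2^ν − 1 roots in
DISTINCT dyadic octaves (`OctaveGlue.octaveThetaWitness`) and the closed `pencilTransfer_proof`
transfers root SETS. Realises the crux
idea `octave-lifting` (val-idea-6) on stmt-19561; sibling of route KPlusLogSqLaw (shares 19771,
replaces 19561 by the weaker Ω-W).
Lean: `TropicalB ∧ OctaveWeakLifting` (the route's two item decls; Ω-W is `Iff.rfl`-equal to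
`Summit.ValiantsHypothesis.ValiantsHypothesis.Theorems.KPlusLogSqLaw.Octave.OctaveWeakLifting`,
p587221/p590287)

## Assembly
Pure composition of tree theorems, Theses-free:
`OctaveGlue.octaveKLaw_of_tropicalB_of_octaveWeakLifting hT hΩ` (the three-line
arithmetic of p417903 in octave form) gives the octave K-law `∃ C, ∀ m K, OctaveRootLawAt m K
(2^{C(K + log² m)})`;
`OctaveGlue.octaveMatrixDescartes_of_octaveKLaw` (StubArith4 `exp_le`) gives octave-MatrixDescartes;
`OctaveGlue.valiant_of_octaveMatrixDescartes`
feeds it, with the CLOSED `LacunarySymmetroid.pencilTransfer_proof` (transfers root sets, hence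
octave counts) and the PROVED octave theta
witness `OctaveGlue.octaveThetaWitness` (Tavenas' `V_ν`: roots in distinct octaves (x_{u+1}, x_u) ⊂
−(2^{4u+2−2N}, 2^{4u+6−2N})), into the
parent assembly. Certified in glue.lean: `theorem closes (hT : TropicalB) (hΩ : OctaveWeakLifting) :
_root_.ValiantsHypothesis :=
OctaveGlue.valiant_of_tropicalB_of_octaveWeakLifting hT hΩ` (one line; axioms propext,
Classical.choice, Quot.sound).

Rationale: WHY THIS LINE. The deciding chain is KERNEL-CHECKED and Theses-free (p589881
`Theorems/KPlusLogSqLawOctaveGlue.lean`: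
`OctaveGlue.valiant_of_tropicalB_of_octaveWeakLifting (hT) (hΩ) : ValiantsHypothesis`, axioms
propext/Classical.choice/Quot.sound; coherence
p590287 `octaveWeakLifting_iff_glueShape : … ↔ … := Iff.rfl`), so the only open content is TB
(shared) and Ω-W. Ω-W is the recorded
obstruction to `WeakLifting` MINUS its clustering half: GAP-LIFT (val-sym-lift-p4) splits lifting
excess into (a) signed Newton-polygon
reshaping by cancellation and (b) extra roots CLUSTERED inside ambiguity windows; the octave count
is blind to (b) by construction and to the
catalogued class `Literature.Barriers.ValiantsHypothesis.TauRealZeros` (Chebyshev / dilated-Dickson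
zero sets have Ω = O(log Z): additive
separation versus multiplicative scales), and (a) is priced by cancellation DEPTH — the first rung
is a THEOREM in the tree:
`Octave.shallowOctaveLifting_proof : ShallowOctaveLifting` (p588911, 0 sorry: every root scale of a
pencil of depth ≤ Δ lies within
m(⌊log₂ mK⌋ + 1) + Δ of a breakpoint of the design envelope, hence Ω ≤ (2(M + Δ) + 3)(n + 1) under
the unsigned tropical row). Sources:
Hrubeš–Yehudayoff doi:10.4230/LIPIcs.CCC.2021.9 (sign-variation / tropical proxies, Open Problem 1),
Koiran–Portier–Tavenas–Thomassé
arXiv:2107.10002 and Koiran2011 (real τ-conjecture door), Viro–Itenberg dequantisation read as an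
UPPER bound on SCALES (pencil-level
root-count lifting is false: Li–Wang zbl:0905.14033; census (2,4): 9 > 8 — all of that excess is
clustering, invisible to Ω). Imported
areas: tropical / parametric combinatorial optimisation (TB), archimedean amoeba geometry (Ω-W).
What it does that the sibling does not:
its lifting crux cannot be killed by any clustering or window-merging family (the two format-level
phenomena recorded against W), and
its negation has forced structure (a ¬Ω-B family with TB true needs cancellation depth ≥ 2^{C(K +
log² m)} for every C, i.e.
doubly-exponential arithmetic height). Negatives index: every refuted statement of the summit about
lacunary pencils is a root-COUNT,
thin-format, derived-pencil or additive-separation statement (`not_DerivedPencilRolle`,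
`not_separatedRealZeroTauBound`, LawsRefuted);
none bounds root scales, and each octave statement is implied by its unrefuted twin (B, W, MDR).

RANKED CRUXES. #2 TropicalB (crux) — TB — there is an absolute C such that for all m, K every
dominance design of format (m, K) (exponents d : Fin K → ℕ, integer valuations v and sign pattern ε
with |ε| ≤ 1 on entries × classes) admits at most 2^{C (K + ⌊log₂ m⌋²)} sign alternations along any
strictly increasing integer parameter sequence of dominant terms (the tree's `IsDominant` /
`termSign` vocabulary; verbatim the signature of stmt-ValiantsHypothesis-19771, shared with route
KPlusLogSqLaw). [difficulty: open-problem] (why it might fail: only monomial counting T < C(m+K−1,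
m) is proved; in the window log₂ m ≪ K ≪ m a K-uniform lex-odometer with ADDITIVE row cost (K
classes on m = K^{O(1)} rows, (m/K)^{Ω(K)} alternations, log₂ T = Ω(K log K)) breaks every C — the
staircase pays ×4 rows per class; nothing located forbids ×(1 + o(1)).)
[doi:10.4230/LIPIcs.CCC.2021.9, arXiv:2107.10002, doi:10.1007/BF02591893,
tree:Summit.ValiantsHypothesis.ValiantsHypothesis.Theorems.KPlusLogSqLaw.tropicalB_hessenberg (rung
of record p421838),
tree:Summit.ValiantsHypothesis.ValiantsHypothesis.Theorems.KPlusLogSqLaw.tropicalB_iff_staticDiagonal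
(p436380)]
#3 OctaveWeakLifting (crux) — Ω-W — there is an absolute C such that for all m, K, n: if every
dominance design of format (m, K) has at most n sign alternations (the TropRow hypothesis, verbatim
as in stmt-19561 `WeakLifting`), then the determinant of every real SYMMETRIC lacunary pencil Σ_l
X^{d_l} S_l of format (m, K) has its nonzero real roots in at most 2^{C (K + ⌊log₂ m⌋²)}·(n + 1)
dyadic octaves (`OctaveGlue.OctaveRootLawAt m K B`: `octaveCount (det Σ_l X^{d_l} • C(S_l)) ≤ B`;
item I1 of crux idea `octave-lifting`, definitionally the landed `Octave.OctaveWeakLifting`).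
[difficulty: XL] (why it might fail: deep signed cancellation (dead slope classes, depth ≫
2^{C(K+log² m)}) can put root SCALES far from every design breakpoint — the proved rung covers
bounded depth only; power-tower witnesses already buy +2..+4 octaves over the design count at (2,4)
with depth 26–40 bits.) [doi:10.4230/LIPIcs.CCC.2021.9, arXiv:2107.10002, zbl:0905.14033,
Koiran2011,
tree:Summit.ValiantsHypothesis.ValiantsHypothesis.Theorems.KPlusLogSqLaw.Octave.shallowOctaveLifting_proof
(rung p588911),
tree:Summit.ValiantsHypothesis.ValiantsHypothesis.Theorems.KPlusLogSqLaw.OctaveGlue.valiant_of_tropicalB_of_octaveWeakLifting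
(glue p589881), crux-idea:stmt-ValiantsHypothesis-19561/octave-lifting]

TWO-LAYER PLAN. OctaveWeakLifting ⇐ DeadClassOctaveLifting (the rung's conclusion with `DepthLE`
relaxed to LIVE classes, `LiveDepthLE`; typed in
Cruxes/WeakLifting/Lines/octave.lean as the next stub candidate, not asserted) → DepthReduction (a
symmetric (m, K) determinant violating the
octave row at parameter C has, after an admissible format-preserving renormalisation, live depth ≤
2^{C'(K + log² m)}) → OctaveWeakLifting;
glue by `shallowOctaveLifting_proof`-shaped composition. Not filed now: the split is registered only
after a prover proposes the exact
`LiveDepthLE` signature that survives the dead-roof family (rank-one letters H·vvᵀ owning the design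
envelope as H → ∞).

KILL CRITERIA. ¬TropicalB by an explicit design family (alternations beating 2^{C(K + log² m)} for
every C) closes the route `refuted:TropicalB` together with its
sibling KPlusLogSqLaw and refutes Conjecture B itself. ¬OctaveWeakLifting — a symmetric format
family whose determinants have super-budget many root
SCALES while the tropical rows stay inside the budget (a «deep-spread monster», necessarily of
doubly-exponential cancellation depth) — closes the
route `refuted:OctaveWeakLifting` AND kills `WeakLifting` / Conjecture B (Ω ≤ Z), leaving only
octave-free doors. `MatrixDescartes` refuted
(stmt-18050) moots everything; `MatrixDescartes`, `KPlusLogSqLaw` or `WeakLifting` proved elsewhere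
supersedes the route (W ⇒ Ω-W).

NOT DECOMPOSED YET. The constants C (any absolute C closes), the dead-class / live-depth split of
Ω-W (layer 2, after a prover types `LiveDepthLE` against the dead-roof
family), the per-octave half of B (`kPlusLogSqLaw_iff_octave_and_perOctave`: NOT needed for Valiant
— the summit consumes only the octave half), and
every root-COUNT refinement (clustering is deliberately invisible here).

CHEAPEST FALSIFIER. Re-read the census power-tower / graft witnesses of record (E1G7-TOWER9 rows,
`PowerTowerBreaksB 2`, eng-1 row #3 «Ω-optimising (2,5)») for OCTAVES
instead of roots: per record compute depth δ, the design-envelope breakpoint count U and the root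
octaves (hub python `instr/table.py` of val-idea-6,
seconds per format). Done so far (val-idea-6, 535 records at (2,4)/(2,5)): `max(disp_d − δ) = −0.63`
at (2,4), +1.1 at (2,5); octave excess over U
appears only with depth (δ ∈ [6,12): ≤ +2; ≥ 12: ≤ +4); the 124 depth-0 fourteens at (2,5) have octs
≤ U − 1 ≤ 8 while Z = 14 > T_sym = 11. A family whose
octave excess over the design count grows faster than 2^{cK} at fixed small m kills Ω-W (and B), not
TB.

NUMBERS. Census of record (cell): ζ(2,4) = 9, ζ(2,5) = 14 (real, certified), T_sym(2,K) = 3K − 4,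
T(2,K) ≤ 4K − 3; octave side (val-idea-6, located, hub
python): per-octave maxima at (2,4) over 385 rows 1:36 2:125 3:117 4:52 5:24 6:12 7:15 8:3 9:1 (nine
roots in ONE octave exist: Ω₊ = 1, P = 9);
spread nines (Ω = 9, span 11 octaves) only at depth ≥ 48 bits. Rung constant: Ω ≤ (2(m(⌊log₂ mK⌋ +
1) + Δ) + 3)(n + 1) at depth ≤ Δ (theorem).

DEFINITION REQUESTS. None: `octaveCount`, `OctaveRootLawAt`, `ShallowOctaveLifting`, `DepthLE` are
tree declarations (Theorems/KPlusLogSqLawOctave*.lean, p587221–p590597).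

Novelty: Searches (2026-08-25/28): lit search --hybrid "parametric assignment problem number of breakpoints"
(0 relevant held); lit vsearch "upper bound on sign alternations of optimal assignment as costs vary
linearly with few slope classes" (0 relevant); lit galaxy search "parametric assignment|parametric
bipartite matching|Itenberg-Roy conjecture" --star all (1 hit, [galaxy:pdf:5196591216032960]
Marchesini, tropical eigenvalue localisation — annuli of eigenvalue MODULI of matrix polynomials,
the nearest thing to an octave count, lower/upper annuli per tropical root, no count of real root
scales); lit search "Viro patchworking upper bound real roots determinant" ([corpus:arxiv-2107.10002
p3], [corpus:arxiv-1809.10825 p9]: lower-bound direction only); lit search --hybrid "number of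
distinct orders of magnitude of real roots fewnomial" (0 relevant held); lean search
'octaveCount|OctaveRootLawAt|TropRootLawAt|IsDominant' (tree: the octave packet p587221–p590597 and
the lower-bound door only).
Nearest prior art found: doi:10.4230/LIPIcs.CCC.2021.9 (Hrubeš–Yehudayoff 2021: sign-variation
proxies for real zeros of sparse structured polynomials, Open Problem 1),
[galaxy:pdf:5196591216032960] (Marchesini et al.: tropical localisation of eigenvalue moduli of
matrix polynomials — annuli, not a scale COUNT against alternations), doi:10.1007/BF02591893
(Carstensen 1983: quasi-polynomial parametric complexity) — none bounds the number of root SCALES of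
a real symmetric lacunary determinant by a  [refs: 10.4230/LIPIcs.CCC.2021.9, 10.1007/BF02591893, arxiv-2107.10002, arxiv-1809.10825, doi:10.4230/LIPIcs.CCC.2021.9, doi:10.1007/BF02591893]

Barriers (technique_class: real-root-counting, tropical-lifting, octave-counting): - technique_class: real-root-counting, tropical-lifting, octave-counting
- Literature.Barriers.ValiantsHypothesis.TauRealZeros: OUTSIDE the class — the wall's Chebyshev
tower T_{2^r}(S₀ + X S₁) and the dilated-Dickson separated family have Ω = O(log Z) root scales
(additive separation, multiplicative octaves), cost size m ≥ 2^{r−1} or K = 2^r + 1 terms in the (m,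
K) format, and both TB and Ω-W are stated per format; the barrier's scope caveat (arithmetic
structure of zero sets not excluded) is exactly where Ω lives.
- Literature.Barriers.ValiantsHypothesis.AlgebraicNaturalProofs: not in the class — TB is a
statement about integer-valued designs, Ω-W an archimedean semialgebraic statement with unbounded
exponents and a floor-of-log statistic; the barrier is conditional and nothing is claimed either
way.
- Literature.Barriers.ValiantsHypothesis.PermanentCharTwo: consistent — TB / Ω-W use the order and
the archimedean absolute value of ℝ; the assembly is over ℂ; nothing characteristic-free is
asserted.
- Literature.Barriers.ValiantsHypothesis.RankMethods: outside — no rank / partial-derivative measure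
appears; the counts are sign alternations and root scales, which rank methods cannot see and whose
barriers (FullRankMultilinear, ShiftedPartialDerivatives, RankLiftingBarrier) do not quantify over.
- Literature.Barriers.ValiantsHypothesis.DepthReductionChasm: not used — no depth reduction of
circuits; the pencil comes from quasi-polynomial determinantal complexity (parent's Pencil

sub-problem: ValiantsHypothesis · status: open · opened planner-pub-symmetroid-conjb-2-g14-0 2026-08-28T01:34:19Z · rev 0 · ledger route-ValiantsHypothesis-KPlusLogSqLawOctave
GENERATED by the gate from the ledger (D-0016/17). Provers cite these decls: `theorem foo : Summit.ValiantsHypothesis.ValiantsHypothesis.Theses.KPlusLogSqLawOctave.<Decl> := …` in Summits/ValiantsHypothesis/ValiantsHypothesis/Theorems/<Name>.lean.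
-/

namespace Summit.ValiantsHypothesis.ValiantsHypothesis.Theses.KPlusLogSqLawOctave

open scoped BigOperators Topology Manifold Classical MeasureTheory ProbabilityTheory Matrix InnerProductSpace ComplexConjugate ContinuousMap
open Filter Set Function TopologicalSpace MeasureTheory

attribute [summit_statement] _root_.ValiantsHypothesis

open Literature.PNP

/-- item stmt-ValiantsHypothesis-19771 · crux · rank 2 · open · by planner
why it might fail: only monomial counting T < C(m+K−1, m) is proved; in the window log₂ m ≪ K ≪ m a K-uniform lex-odometer with ADDITIVE row cost (K classes on m = K^{O(1)} rows, (m/K)^{Ω(K)} alternations, log₂ T = Ω(K log K)) breaks every C — the staircase pays ×4 rows per class; nothing located forbids ×(1 + o(1)).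
sources: doi:10.4230/LIPIcs.CCC.2021.9, arXiv:2107.10002, doi:10.1007/BF02591893, tree:Summit.ValiantsHypothesis.ValiantsHypothesis.Theorems.KPlusLogSqLaw.tropicalB_hessenberg (rung of record p421838), tree:Summit.ValiantsHypothesis.ValiantsHypothesis.Theorems.KPlusLogSqLaw.tropicalB_iff_staticDiagonal (p436380)
[crux] TB — there is an absolute C such that for all m, K every dominance design of format (m, K)
(exponents d : Fin K → ℕ, integer valuations v and sign pattern ε with |ε| ≤ 1 on entries × classes)
admits at most 2^{C (K + ⌊log₂ m⌋²)} sign alternations along any strictly increasing integer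
parameter sequence of dominant terms (`TropicalCensus.TropRootLawAt`, δ-equal to
`TropicalCensus.TropKPlusLogSqLaw`). [difficulty: open-problem] -/
@[route_item "route-ValiantsHypothesis-KPlusLogSqLawOctave", crux]
def TropicalB : Prop :=
  ∃ C : ℕ, ∀ (m K : ℕ), ∀ (d : Fin K → ℕ) (v ε : Fin m → Fin m → Fin K → ℤ) (n : ℕ) (θ : Fin (n + 1) → ℤ) (p : Fin (n + 1) → Equiv.Perm (Fin m) × (Fin m → Fin K)), (∀ i j l, (ε i j l).natAbs ≤ 1) → StrictMono θ → (∀ k, Summit.ValiantsHypothesis.ValiantsHypothesis.Theorems.MatrixDescartes.Negative.IsDominant d v ε (θ k) (p k)) → (∀ k : Fin n, Summit.ValiantsHypothesis.ValiantsHypothesis.Theorems.MatrixDescartes.Negative.termSign ε (p k.castSucc) * Summit.ValiantsHypothesis.ValiantsHypothesis.Theorems.MatrixDescartes.Negative.termSign ε (p k.succ) < 0) → n ≤ 2 ^ (C * (K + Nat.log 2 m ^ 2))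

/-- item stmt-ValiantsHypothesis-24457 · crux · rank 3 · open · by planner
why it might fail: deep signed cancellation (dead slope classes, depth ≫ 2^{C(K+log² m)}) can put root SCALES far from every design breakpoint — the proved rung covers bounded depth only; power-tower witnesses already buy +2..+4 octaves over the design count at (2,4) with depth 26–40 bits.
sources: doi:10.4230/LIPIcs.CCC.2021.9, arXiv:2107.10002, zbl:0905.14033, Koiran2011, tree:Summit.ValiantsHypothesis.ValiantsHypothesis.Theorems.KPlusLogSqLaw.Octave.shallowOctaveLifting_proof (rung p588911), tree:Summit.ValiantsHypothesis.ValiantsHypothesis.Theorems.KPlusLogSqLaw.OctaveGlue.valiant_of_tropicalB_of_octaveWeakLifting (glue p589881)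
[crux] Ω-W — there is an absolute C such that for all m, K, n: if every dominance design of format
(m, K) has at most n sign alternations (the TropRow hypothesis, verbatim as in stmt-19561
`WeakLifting`), then the determinant of every real SYMMETRIC lacunary pencil Σ_l X^{d_l} S_l of
format (m, K) has its nonzero real roots in at most 2^{C (K + ⌊log₂ m⌋²)}·(n + 1) dyadic octaves
(`OctaveGlue.OctaveRootLawAt m K B`: `octaveCount (det Σ_l X^{d_l} • C(S_l)) ≤ B`; item I1 of crux
idea `octave-lifting`, definitionally the landed `Octave.OctaveWeakLifting`). [difficulty: XL] -/
@[route_item "route-ValiantsHypothesis-KPlusLogSqLawOctave", crux]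
def OctaveWeakLifting : Prop :=
  ∃ C : ℕ, ∀ (m K n : ℕ), (∀ (d : Fin K → ℕ) (v ε : Fin m → Fin m → Fin K → ℤ) (n' : ℕ) (θ : Fin (n' + 1) → ℤ) (p : Fin (n' + 1) → Equiv.Perm (Fin m) × (Fin m → Fin K)), (∀ i j l, (ε i j l).natAbs ≤ 1) → StrictMono θ → (∀ k, Summit.ValiantsHypothesis.ValiantsHypothesis.Theorems.MatrixDescartes.Negative.IsDominant d v ε (θ k) (p k)) → (∀ k : Fin n', Summit.ValiantsHypothesis.ValiantsHypothesis.Theorems.MatrixDescartes.Negative.termSign ε (p k.castSucc) * Summit.ValiantsHypothesis.ValiantsHypothesis.Theorems.MatrixDescartes.Negative.termSign ε (p k.succ) < 0) → n' ≤ n) → Summit.ValiantsHypothesis.ValiantsHypothesis.Theorems.KPlusLogSqLaw.OctaveGlue.OctaveRootLawAt m K (2 ^ (C * (K + Nat.log 2 m ^ 2)) * (n + 1))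

/-- item stmt-ValiantsHypothesis-24458 · assembly · rank 1 · open · by planner
sources: Koiran2011, doi:10.4230/LIPIcs.CCC.2021.9
[assembly] TropicalB → OctaveWeakLifting → VP_ℂ ≠ VNP_ℂ. -/
@[route_item "route-ValiantsHypothesis-KPlusLogSqLawOctave"]
def Assembly : Prop :=
  TropicalB → OctaveWeakLifting → _root_.ValiantsHypothesis

/-! D-0027 §2.1 — DECIDING THEOREM (planner-authored via `route open/edit --closes-file`; by planner-pub-symmetroid-conjb-2-g14-0 2026-08-28T01:34:19Z):
its hypotheses are this route's items and its conclusion the sub-problem Statement (glue_lint), and it elaborates with this file. -/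

@[closes "route-ValiantsHypothesis-KPlusLogSqLawOctave"] theorem closes (hT : TropicalB) (hΩ : OctaveWeakLifting) : _root_.ValiantsHypothesis :=
  Summit.ValiantsHypothesis.ValiantsHypothesis.Theorems.KPlusLogSqLaw.OctaveGlue.valiant_of_tropicalB_of_octaveWeakLifting hT hΩ

end Summit.ValiantsHypothesis.ValiantsHypothesis.Theses.KPlusLogSqLawOctave
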